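import Mathlib
import HarnessLib
import Literature.Analysis.Complex.HolomorphicParametricIntegral

/-!
# The lens chart of the angular trace (helpers of stub `stub_angleBandLimit`,
crux `PencilRigidity.ShellRigidity`, line `thales-slit-exact-cone-type`, stmt-QuantumFields-11685)

Informal content. Let `μ` be a finite measure on momentum space `ℝ⁴` carried by the light cone
`{p₀ ≥ |p₁|}` (`μ {p₀ < |p₁|} = 0`), `t > 0`, `ε > 0`, `y, z ∈ ℝ`. The **chart**
`H_ε(w) = ∫ exp(-(t cos w - ε) p₀ + i (t sin w p₁ + y p₂ + z p₃)) dμ(p)` (complex `cos`, `sin`)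
has an integrand of modulus `≤ exp(-(t cos(Re w) e^{-|Im w|} - ε) p₀)` on the cone
(`norm_integrand_le`: `Re cos w = cos α ch ψ`, `Im sin w = cos α sh ψ`, `ch ψ - |sh ψ| = e^{-|ψ|}`),
hence it is holomorphic on the **lens** `{w : ε < t cos(Re w) e^{-|Im w|}}` (dominated holomorphic
parameter integrals, `Literature.Analysis.Complex.differentiableOn_integral_of_dominated`;
`differentiableOn_chart`), at real `α` with `ε ≤ t cos α` it is the axis Laplace representation of
`K(t cos α, t sin α, y, z)` (`chart_ofReal`), it is bounded by `K(m e₀) ≤ C(1 + m^{-a})` at level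
`m = t cos(Re w) e^{-|Im w|}` (`norm_chart_le`), and at the imaginary angle `iχ` its integrand is
`exp(-(t ch χ - ε) p₀ - t sh χ p₁ + i(y p₂ + z p₃))` (`integrand_mul_I`); these four facts are packaged as
the registered sub-goal `stub_angleBandLimitChart`.

The last section is pure complex analysis: the identity theorem on open rectangles from their real
points (`eqOn_rect_of_eqOn_real`) and the elementary lens geometry (`half_lt_cos`,
`level_gt_of_re_lt`, `level_gt_of_mem_rect`). The gluing of the levels, the periodic entire
extension and the band limitation are in the files `PencilRigidityShellRigidityAngleBandLimitExtension`
and `PencilRigidityShellRigidityAngleBandLimit`. Everything is folklore complex analysis; no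
definitions, no named facts. Helpers live in the sub-namespace `AngleBandLimit`.
-/

noncomputable section

namespace Summit.QuantumFields.YangMills.Cruxes.ShellRigidity.ThalesSlitExactConeType

open MeasureTheory Complex Real
open scoped InnerProductSpace BigOperators

local notation "E4" => EuclideanSpace ℝ (Fin 4)

namespace AngleBandLimit

open Set Filter Metric Topology

/-! ## The integrand of the chart -/

/-- `Re cos w = cos(Re w) ch(Im w)`. -/
theorem cos_re_eq (w : ℂ) : (Complex.cos w).re = Real.cos w.re * Real.cosh w.im := by
  rw [Complex.cos_eq]
  simp [Complex.cos_ofReal_re, Complex.sin_ofReal_re, Complex.cosh_ofReal_re,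
    Complex.sinh_ofReal_re, Complex.cosh_ofReal_im, Complex.sinh_ofReal_im]

/-- `Im sin w = cos(Re w) sh(Im w)`. -/
theorem sin_im_eq (w : ℂ) : (Complex.sin w).im = Real.cos w.re * Real.sinh w.im := by
  rw [Complex.sin_eq]
  simp [Complex.cos_ofReal_re, Complex.sin_ofReal_re, Complex.cosh_ofReal_re,
    Complex.sinh_ofReal_re, Complex.cosh_ofReal_im, Complex.sinh_ofReal_im]

/-- The real part of the exponent of the chart integrand at `w = α + iψ`:
`-(t cos α ch ψ - ε) p₀ - t cos α sh ψ p₁`. -/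
theorem exponent_re (t ε y z : ℝ) (w : ℂ) (p : E4) :
    (-((t : ℂ) * Complex.cos w - ε) * (p 0 : ℂ) +
        ((t : ℂ) * Complex.sin w * (p 1 : ℂ) + ((y * p 2 + z * p 3 : ℝ) : ℂ)) * I).re =
      -(t * (Real.cos w.re * Real.cosh w.im) - ε) * p 0 -
        t * (Real.cos w.re * Real.sinh w.im) * p 1 := by
  simp [cos_re_eq, sin_im_eq]
  ring

/-- `ch ψ - |sh ψ| = e^{-|ψ|}`. -/
theorem cosh_sub_abs_sinh (ψ : ℝ) : Real.cosh ψ - |Real.sinh ψ| = Real.exp (-|ψ|) := by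
  rcases le_or_gt 0 ψ with h | h
  · rw [abs_of_nonneg (Real.sinh_nonneg_iff.2 h), abs_of_nonneg h, Real.cosh_sub_sinh]
  · rw [abs_of_neg (Real.sinh_neg_iff.2 h), abs_of_neg h, sub_neg_eq_add, neg_neg,
      Real.cosh_add_sinh]

/-- **The integrand on the cone.** For `|p₁| ≤ p₀` and `t cos(Re w) ≥ 0` the chart integrand has
modulus `≤ exp(-(t cos(Re w) e^{-|Im w|} - ε) p₀)`. -/
theorem norm_integrand_le {t ε y z : ℝ} {w : ℂ} {p : E4} (hp : |p 1| ≤ p 0)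
    (ht : 0 ≤ t * Real.cos w.re) :
    ‖cexp (-((t : ℂ) * Complex.cos w - ε) * (p 0 : ℂ) +
        ((t : ℂ) * Complex.sin w * (p 1 : ℂ) + ((y * p 2 + z * p 3 : ℝ) : ℂ)) * I)‖ ≤
      Real.exp (-(t * Real.cos w.re * Real.exp (-|w.im|) - ε) * p 0) := by
  rw [Complex.norm_exp, exponent_re, Real.exp_le_exp, ← cosh_sub_abs_sinh]
  have h1 : -(|Real.sinh w.im| * p 0) ≤ Real.sinh w.im * p 1 := by
    have h2 := neg_abs_le (Real.sinh w.im * p 1)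
    have h3 : |Real.sinh w.im| * |p 1| ≤ |Real.sinh w.im| * p 0 :=
      mul_le_mul_of_nonneg_left hp (abs_nonneg _)
    rw [abs_mul] at h2
    linarith
  nlinarith [mul_nonneg ht (by linarith : 0 ≤ Real.sinh w.im * p 1 + |Real.sinh w.im| * p 0)]

/-- The cone condition `μ {p₀ < |p₁|} = 0`, almost everywhere. -/
theorem ae_abs_le (μ : Measure E4) (hcone : μ {p : E4 | p 0 < |p 1|} = 0) :
    ∀ᵐ p ∂μ, |p 1| ≤ p 0 := by
  rw [ae_iff]
  simpa only [not_le] using hcone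

/-- On the lens of a positive level the cosine of the real part is positive. -/
theorem cos_mul_nonneg_of_lt_level {t ε : ℝ} (hε : 0 < ε) {w : ℂ}
    (hw : ε < t * Real.cos w.re * Real.exp (-|w.im|)) : 0 ≤ t * Real.cos w.re :=
  (pos_of_mul_pos_left (hε.trans hw) (Real.exp_pos _).le).le

/-- The lens `{w : ε < t cos(Re w) e^{-|Im w|}}` is open. -/
theorem isOpen_lens (t ε : ℝ) :
    IsOpen {w : ℂ | ε < t * Real.cos w.re * Real.exp (-|w.im|)} :=
  isOpen_lt continuous_const (by fun_prop)

/-! ## The chart: holomorphy, real points, bound, imaginary angle -/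

/-- **Holomorphy of the chart on the lens.** For a finite measure carried by the cone the chart
`w ↦ ∫ exp(-(t cos w - ε) p₀ + i(t sin w p₁ + y p₂ + z p₃)) dμ` is holomorphic on
`{ε < t cos(Re w) e^{-|Im w|}}` (`ε > 0`): there the integrand is bounded by `1` on the cone, and
holomorphic dominated parameter integrals are holomorphic
(`Literature.Analysis.Complex.differentiableOn_integral_of_dominated`). -/
theorem differentiableOn_chart (μ : Measure E4) [IsFiniteMeasure μ]
    (hcone : μ {p : E4 | p 0 < |p 1|} = 0) {ε : ℝ} (hε : 0 < ε) (t y z : ℝ) :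
    DifferentiableOn ℂ (fun w => ∫ p, cexp (-((t : ℂ) * Complex.cos w - ε) * (p 0 : ℂ) +
        ((t : ℂ) * Complex.sin w * (p 1 : ℂ) + ((y * p 2 + z * p 3 : ℝ) : ℂ)) * I) ∂μ)
      {w : ℂ | ε < t * Real.cos w.re * Real.exp (-|w.im|)} := by
  refine Literature.Analysis.Complex.differentiableOn_integral_of_dominated
    (fun w _ => (by fun_prop : Continuous fun p : E4 =>
      cexp (-((t : ℂ) * Complex.cos w - ε) * (p 0 : ℂ) +
        ((t : ℂ) * Complex.sin w * (p 1 : ℂ) + ((y * p 2 + z * p 3 : ℝ) : ℂ)) * I)).aestronglyMeasurable)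
    (Eventually.of_forall fun p => (by fun_prop : Differentiable ℂ fun w : ℂ =>
      cexp (-((t : ℂ) * Complex.cos w - ε) * (p 0 : ℂ) +
        ((t : ℂ) * Complex.sin w * (p 1 : ℂ) + ((y * p 2 + z * p 3 : ℝ) : ℂ)) * I)).differentiableOn)
    fun w₀ hw₀ => ?_
  obtain ⟨R, hR, hball⟩ := Metric.isOpen_iff.1 (isOpen_lens t ε) w₀ hw₀
  refine ⟨R, hR, hball, fun _ => 1, integrable_const _, ?_⟩
  filter_upwards [ae_abs_le μ hcone] with p hp
  intro w hw
  have hw' : ε < t * Real.cos w.re * Real.exp (-|w.im|) := hball hw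
  refine (norm_integrand_le hp (cos_mul_nonneg_of_lt_level hε hw')).trans ?_
  rw [Real.exp_le_one_iff]
  have h0 : 0 ≤ p 0 := (abs_nonneg _).trans hp
  nlinarith [mul_nonneg (sub_nonneg.2 hw'.le) h0]

/-- **Real points of the chart.** If `K((ε + s) e₀ + v) = ∫ e^{-s p₀ + i⟪v,p⟫} dμ` for `s ≥ 0`,
`v ⊥ e₀`, then at a real angle `α` with `ε ≤ t cos α` the chart is `K(t cos α, t sin α, y, z)`
(time `t cos α = ε + (t cos α - ε)`, `v = t sin α e₁ + y e₂ + z e₃`). -/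
theorem chart_ofReal (μ : Measure E4) (K : E4 → ℝ) {t ε : ℝ} (y z : ℝ)
    (hrep : ∀ s : ℝ, 0 ≤ s → ∀ v : E4, v 0 = 0 →
      ((K (EuclideanSpace.single 0 (ε + s) + v) : ℝ) : ℂ) =
        ∫ p, cexp ((((-(s * p 0) : ℝ)) : ℂ) + ((⟪v, p⟫_ℝ : ℝ) : ℂ) * I) ∂μ)
    {α : ℝ} (hα : ε ≤ t * Real.cos α) :
    (∫ p, cexp (-((t : ℂ) * Complex.cos α - ε) * (p 0 : ℂ) +
        ((t : ℂ) * Complex.sin α * (p 1 : ℂ) + ((y * p 2 + z * p 3 : ℝ) : ℂ)) * I) ∂μ) =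
      ((K (WithLp.toLp 2 ![t * Real.cos α, t * Real.sin α, y, z]) : ℝ) : ℂ) := by
  have h := hrep (t * Real.cos α - ε) (sub_nonneg.2 hα)
    (WithLp.toLp 2 ![0, t * Real.sin α, y, z]) (by simp)
  have hx : EuclideanSpace.single 0 (ε + (t * Real.cos α - ε)) +
      (WithLp.toLp 2 ![0, t * Real.sin α, y, z] : E4) =
        WithLp.toLp 2 ![t * Real.cos α, t * Real.sin α, y, z] := by
    ext i
    fin_cases i <;> simp
  rw [hx] at h
  rw [h]
  refine integral_congr_ae (Eventually.of_forall fun p => ?_)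
  have hinner : ⟪(WithLp.toLp 2 ![0, t * Real.sin α, y, z] : E4), p⟫_ℝ =
      t * Real.sin α * p 1 + y * p 2 + z * p 3 := by
    simp [PiLp.inner_apply, Fin.sum_univ_four]
    ring
  beta_reduce
  rw [hinner, ← Complex.ofReal_cos, ← Complex.ofReal_sin]
  push_cast
  ring_nf

/-- **Bound of the chart.** On the lens the chart is bounded by the time-axis value `K(m e₀)` at
the level `m = t cos(Re w) e^{-|Im w|}` (`|integrand| ≤ e^{-(m - ε) p₀}` on the cone, whose integral
is `K(m e₀)` by the representation at `v = 0`), hence by `C(1 + m^{-a})`. -/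
theorem norm_chart_le (μ : Measure E4) [IsFiniteMeasure μ] (hcone : μ {p : E4 | p 0 < |p 1|} = 0)
    (K : E4 → ℝ) {C a t ε : ℝ} (y z : ℝ) (hε : 0 < ε)
    (hdecay : ∀ x : E4, x ≠ 0 → |K x| ≤ C * (1 + ‖x‖ ^ (-a)))
    (hrep : ∀ s : ℝ, 0 ≤ s → ∀ v : E4, v 0 = 0 →
      ((K (EuclideanSpace.single 0 (ε + s) + v) : ℝ) : ℂ) =
        ∫ p, cexp ((((-(s * p 0) : ℝ)) : ℂ) + ((⟪v, p⟫_ℝ : ℝ) : ℂ) * I) ∂μ)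
    {w : ℂ} (hw : ε < t * Real.cos w.re * Real.exp (-|w.im|)) :
    ‖∫ p, cexp (-((t : ℂ) * Complex.cos w - ε) * (p 0 : ℂ) +
        ((t : ℂ) * Complex.sin w * (p 1 : ℂ) + ((y * p 2 + z * p 3 : ℝ) : ℂ)) * I) ∂μ‖ ≤
      C * (1 + (t * Real.cos w.re * Real.exp (-|w.im|)) ^ (-a)) := by
  set m := t * Real.cos w.re * Real.exp (-|w.im|) with hm
  have hm0 : 0 < m := hε.trans hw
  have hcos : 0 ≤ t * Real.cos w.re := cos_mul_nonneg_of_lt_level hε hw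
  -- the real integral `∫ e^{-(m - ε) p₀} dμ = K(m e₀)`
  have hK : ((K (EuclideanSpace.single 0 m) : ℝ) : ℂ) =
      ((∫ p, Real.exp (-((m - ε) * p 0)) ∂μ : ℝ) : ℂ) := by
    have h := hrep (m - ε) (sub_nonneg.2 hw.le) 0 rfl
    rw [add_zero, show ε + (m - ε) = m by ring] at h
    rw [h]
    have h2 : (∫ p, cexp ((((-((m - ε) * p 0)) : ℝ) : ℂ) + ((⟪(0 : E4), p⟫_ℝ : ℝ) : ℂ) * I) ∂μ) =
        ∫ p, ((Real.exp (-((m - ε) * p 0)) : ℝ) : ℂ) ∂μ := by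
      refine integral_congr_ae (Eventually.of_forall fun p => ?_)
      simp only [inner_zero_left, Complex.ofReal_zero, zero_mul, add_zero, Complex.ofReal_exp]
    rw [h2]
    exact integral_ofReal
  have hreal : ∫ p, Real.exp (-((m - ε) * p 0)) ∂μ = K (EuclideanSpace.single 0 m) := by
    exact_mod_cast hK.symm
  have hint : Integrable (fun p : E4 => Real.exp (-((m - ε) * p 0))) μ := by
    refine (integrable_const (1 : ℝ)).mono'
      (by fun_prop : Continuous fun p : E4 => Real.exp (-((m - ε) * p 0))).aestronglyMeasurable ?_
    filter_upwards [ae_abs_le μ hcone] with p hp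
    rw [Real.norm_eq_abs, abs_of_pos (Real.exp_pos _), Real.exp_le_one_iff]
    have h0 : 0 ≤ p 0 := (abs_nonneg _).trans hp
    nlinarith [mul_nonneg (sub_nonneg.2 hw.le) h0]
  calc ‖∫ p, cexp (-((t : ℂ) * Complex.cos w - ε) * (p 0 : ℂ) +
        ((t : ℂ) * Complex.sin w * (p 1 : ℂ) + ((y * p 2 + z * p 3 : ℝ) : ℂ)) * I) ∂μ‖
      ≤ ∫ p, Real.exp (-((m - ε) * p 0)) ∂μ := by
        refine norm_integral_le_of_norm_le hint ?_
        filter_upwards [ae_abs_le μ hcone] with p hp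
        refine (norm_integrand_le hp hcos).trans (le_of_eq ?_)
        rw [hm]
        ring_nf
    _ = K (EuclideanSpace.single 0 m) := hreal
    _ ≤ |K (EuclideanSpace.single 0 m)| := le_abs_self _
    _ ≤ C * (1 + ‖(EuclideanSpace.single 0 m : E4)‖ ^ (-a)) :=
        hdecay _ (by rw [Ne, PiLp.single_eq_zero_iff]; exact hm0.ne')
    _ = C * (1 + m ^ (-a)) := by rw [PiLp.norm_single, Real.norm_eq_abs, abs_of_pos hm0]

/-- **The integrand at the imaginary angle `iχ`**: `cos(iχ) = ch χ`, `sin(iχ) = i sh χ`, so the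
exponent is `-(t ch χ - ε) p₀ - t sh χ p₁ + i(y p₂ + z p₃)`. -/
theorem integrand_mul_I (t ε y z χ : ℝ) (p : E4) :
    cexp (-((t : ℂ) * Complex.cos (χ * I) - ε) * (p 0 : ℂ) +
        ((t : ℂ) * Complex.sin (χ * I) * (p 1 : ℂ) + ((y * p 2 + z * p 3 : ℝ) : ℂ)) * I) =
      cexp ((((-((t * Real.cosh χ - ε) * p 0 + t * Real.sinh χ * p 1)) : ℝ) : ℂ) +
        ((y * p 2 + z * p 3 : ℝ) : ℂ) * I) := by
  rw [Complex.cos_mul_I, Complex.sin_mul_I]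
  congr 1
  push_cast
  linear_combination ((t : ℂ) * Complex.sinh χ * (p 1 : ℂ)) * Complex.I_sq

/-! ## Lens geometry -/

/-- `cos s > 1/2` for `|s| < π/3`. -/
theorem half_lt_cos {s : ℝ} (hs : |s| < π / 3) : 1 / 2 < Real.cos s := by
  rw [← Real.cos_pi_div_three, ← Real.cos_abs s]
  exact Real.cos_lt_cos_of_nonneg_of_le_pi (abs_nonneg s) (by linarith [Real.pi_pos]) hs

/-- On the strip `|Re w| < π/3` the level is `> (t/2) e^{-|Im w|}`. -/
theorem level_gt_of_re_lt {t : ℝ} (ht : 0 < t) {w : ℂ} (hw : |w.re| < π / 3) :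
    t / 2 * Real.exp (-|w.im|) < t * Real.cos w.re * Real.exp (-|w.im|) := by
  have h1 := half_lt_cos hw
  have h2 := Real.exp_pos (-|w.im|)
  nlinarith [mul_pos (mul_pos ht (sub_pos.2 h1)) h2]

/-- On the rectangle `{|Re w| < π/3, |Im w| < L}` the level is `> (t/2) e^{-L}`. -/
theorem level_gt_of_mem_rect {t L : ℝ} (ht : 0 < t) {w : ℂ} (hw : |w.re| < π / 3)
    (hL : |w.im| < L) : t / 2 * Real.exp (-L) < t * Real.cos w.re * Real.exp (-|w.im|) :=
  lt_trans (mul_lt_mul_of_pos_left (Real.exp_lt_exp.2 (by linarith)) (by positivity))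
    (level_gt_of_re_lt ht hw)

/-! ## Identity theorem on rectangles from the real points -/

/-- **Identity theorem on an open rectangle from its real points.** Two functions holomorphic on
`{|Re w - c| < A, |Im w| < L}` which agree at the real points `|s - c| < A` agree on the
rectangle (the rectangle is convex, hence preconnected, and the real points accumulate at `c`). -/
theorem eqOn_rect_of_eqOn_real {f g : ℂ → ℂ} {c A L : ℝ}
    (hf : DifferentiableOn ℂ f {w : ℂ | |w.re - c| < A ∧ |w.im| < L})
    (hg : DifferentiableOn ℂ g {w : ℂ | |w.re - c| < A ∧ |w.im| < L})
    (hfg : ∀ s : ℝ, |s - c| < A → f s = g s) :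
    EqOn f g {w : ℂ | |w.re - c| < A ∧ |w.im| < L} := by
  have hUo : IsOpen {w : ℂ | |w.re - c| < A ∧ |w.im| < L} := by
    rw [Set.setOf_and]
    exact (isOpen_lt (by fun_prop) continuous_const).inter (isOpen_lt (by fun_prop) continuous_const)
  set U : Set ℂ := {w : ℂ | |w.re - c| < A ∧ |w.im| < L} with hU
  rcases le_or_gt L 0 with hL | hL
  · exact fun w hw => absurd hw.2 (not_lt.2 (hL.trans (abs_nonneg _)))
  rcases le_or_gt A 0 with hA | hA
  · exact fun w hw => absurd hw.1 (not_lt.2 (hA.trans (abs_nonneg _)))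
  have hUc : Convex ℝ U := by
    have hU' : U = ({w : ℂ | c - A < w.re} ∩ {w : ℂ | w.re < c + A}) ∩
        ({w : ℂ | -L < w.im} ∩ {w : ℂ | w.im < L}) := by
      ext w
      simp only [hU, mem_setOf_eq, mem_inter_iff, abs_lt]
      constructor
      · rintro ⟨⟨h1, h2⟩, h3, h4⟩; exact ⟨⟨by linarith, by linarith⟩, h3, h4⟩
      · rintro ⟨⟨h1, h2⟩, h3, h4⟩; exact ⟨⟨by linarith, by linarith⟩, h3, h4⟩
    rw [hU']
    exact ((convex_halfSpace_re_gt _).inter (convex_halfSpace_re_lt _)).inter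
      ((convex_halfSpace_im_gt _).inter (convex_halfSpace_im_lt _))
  have hc0 : ((c : ℝ) : ℂ) ∈ U := by simp [hU, hA, hL]
  refine (hf.analyticOnNhd hUo).eqOn_of_preconnected_of_frequently_eq (hg.analyticOnNhd hUo)
    hUc.isPreconnected hc0 ?_
  have htend : Tendsto (fun s : ℝ => (s : ℂ)) (𝓝[≠] c) (𝓝[≠] ((c : ℝ) : ℂ)) := by
    refine tendsto_nhdsWithin_of_tendsto_nhds_of_eventually_within _
      (Complex.continuous_ofReal.continuousAt.mono_left nhdsWithin_le_nhds) ?_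
    filter_upwards [self_mem_nhdsWithin] with s hs
    simpa using hs
  have hev : ∀ᶠ s : ℝ in 𝓝[≠] c, f s = g s := by
    have h1 : ∀ᶠ s : ℝ in 𝓝 c, |s - c| < A := by
      filter_upwards [Metric.ball_mem_nhds c hA] with s hs
      rwa [Metric.mem_ball, Real.dist_eq] at hs
    exact (h1.filter_mono nhdsWithin_le_nhds).mono fun s hs => hfg s hs
  exact htend.frequently hev.frequently


end AngleBandLimit

/-! ## The chart package (registered sub-goal `stub_angleBandLimitChart`) -/

open AngleBandLimit in
/-- **The lens chart package.** For a finite measure `μ` on `ℝ⁴` carried by the light cone, a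
kernel `K` with `|K x| ≤ C(1 + ‖x‖^{-a})` represented at level `ε > 0` along the time axis by `μ`
(`K((ε+s)e₀ + v) = ∫ e^{-s p₀ + i⟪v,p⟫} dμ`, `s ≥ 0`, `v ⊥ e₀`), the chart
`H(w) = ∫ exp(-(t cos w - ε)p₀ + i(t sin w p₁ + y p₂ + z p₃)) dμ` is holomorphic on the lens
`{ε < t cos(Re w) e^{-|Im w|}}` (`differentiableOn_chart`), equals `K(t cos α, t sin α, y, z)` at the
real angles with `ε ≤ t cos α` (`chart_ofReal`), is bounded by `C(1 + (t cos(Re w) e^{-|Im w|})^{-a})`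
on the lens (`norm_chart_le`), and at `iχ` it is the integral of
`exp(-(t ch χ - ε)p₀ - t sh χ p₁ + i(y p₂ + z p₃))` (`integrand_mul_I`). -/
theorem stub_angleBandLimitChart (μ : Measure E4) [IsFiniteMeasure μ]
    (hcone : μ {p : E4 | p 0 < |p 1|} = 0) (K : E4 → ℝ) (C a t ε y z : ℝ) (hε : 0 < ε)
    (hdecay : ∀ x : E4, x ≠ 0 → |K x| ≤ C * (1 + ‖x‖ ^ (-a)))
    (hrep : ∀ s : ℝ, 0 ≤ s → ∀ v : E4, v 0 = 0 →
      ((K (EuclideanSpace.single 0 (ε + s) + v) : ℝ) : ℂ) =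
        ∫ p, cexp ((((-(s * p 0) : ℝ)) : ℂ) + ((⟪v, p⟫_ℝ : ℝ) : ℂ) * I) ∂μ)
    (H : ℂ → ℂ) (hH : ∀ w : ℂ, H w = ∫ p, cexp (-((t : ℂ) * Complex.cos w - ε) * (p 0 : ℂ) +
        ((t : ℂ) * Complex.sin w * (p 1 : ℂ) + ((y * p 2 + z * p 3 : ℝ) : ℂ)) * I) ∂μ) :
    DifferentiableOn ℂ H {w : ℂ | ε < t * Real.cos w.re * Real.exp (-|w.im|)} ∧
    (∀ α : ℝ, ε ≤ t * Real.cos α →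
      H α = ((K (WithLp.toLp 2 ![t * Real.cos α, t * Real.sin α, y, z]) : ℝ) : ℂ)) ∧
    (∀ w : ℂ, ε < t * Real.cos w.re * Real.exp (-|w.im|) →
      ‖H w‖ ≤ C * (1 + (t * Real.cos w.re * Real.exp (-|w.im|)) ^ (-a))) ∧
    (∀ χ : ℝ, H (χ * I) =
      ∫ p, cexp ((((-((t * Real.cosh χ - ε) * p 0 + t * Real.sinh χ * p 1)) : ℝ) : ℂ) +
        ((y * p 2 + z * p 3 : ℝ) : ℂ) * I) ∂μ) := by
  have hH' : H = fun w => ∫ p, cexp (-((t : ℂ) * Complex.cos w - ε) * (p 0 : ℂ) +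
      ((t : ℂ) * Complex.sin w * (p 1 : ℂ) + ((y * p 2 + z * p 3 : ℝ) : ℂ)) * I) ∂μ := funext hH
  refine ⟨hH' ▸ differentiableOn_chart μ hcone hε t y z, fun α hα => ?_, fun w hw => ?_,
    fun χ => ?_⟩
  · rw [hH]; exact chart_ofReal μ K y z hrep hα
  · rw [hH]; exact norm_chart_le μ hcone K y z hε hdecay hrep hw
  · rw [hH]; exact integral_congr_ae (ae_of_all _ fun p => integrand_mul_I t ε y z χ p)

end Summit.QuantumFields.YangMills.Cruxes.ShellRigidity.ThalesSlitExactConeType
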